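import Summits.KontsevichZagierPeriods.KontsevichZagierPeriods.Theorems.LinRedNormalFormWheelThreeSpokesCharts

/-!
# `WheelThreeSpokes` (stmt-KontsevichZagierPeriods-3913), line `laplacian-ldl-chart`:
Möbius storage of the logarithm (`stub_moebius`)

After the doubling step the chain of the line sits on
`P2 = {0<u, 0<v, u+v<1, v < w(1−u), w < 1, u(1−u−v) < d₂(1−w)}` (coordinates
`p = (u, v, w, d₂)`) with the integrand `1/(d₂(α + βd₂))`, `α := v(1−u−v) > 0`,
`β := w(1−w) > 0` — the `d₂`-derivative of `α⁻¹·log(βd₂/(α + βd₂))`, whose primitive is NOT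
an admissible (semialgebraic) one. Instead the would-be logarithm is *stored* in a Möbius
coordinate: ONE change of variables (Kontsevich–Zagier rule (2)) along the rational chart

  `C(u, v, w, d₂) = (u, v, s, w)`, `s := βd₂/(α + βd₂) ∈ (0, 1)`,

from `P2` onto `Q = {0<u, 0<v, u+v<1, v < w(1−u), w < 1, wu < s(v+wu), s < 1}` (coordinates
`q = (u, v, s, w)`: the unipotent coordinate `w` of the LDLᵀ chart is put LAST for the subsequent
Newton–Leibniz descent). Its Jacobian determinant is `−∂s/∂d₂ = −αβ/(α+βd₂)²` (the coordinate
swap `(w, d₂) ↦ (s, w)` makes it negative), its inverse is `d₂ = αs/(β(1−s))`, and the pulled-back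
integrand is `w`-free: `1/(d₂(α+βd₂)) = [1/(αs)]∘C · αβ/(α+βd₂)²`.

This file: the chart as a quotient of polynomial vectors `P = (X₀, X₁, βX₃, X₂)`,
`Q = (1, 1, α + βX₃, 1)` (so three rows of the Jacobian matrix are unit vectors), its values,
Jacobian determinant `J_P/J_Q`, `J_P = −αβ`, `J_Q = (α + βX₃)²`, injectivity on `P2`, image
`C '' P2 = Q`, the pull-back identity, and the stub: existence transport `Q ⇒ P2` and the move
`[P2] − [Q] ∈ relations`, both read off `ratChart_transport`.

References: M. Kontsevich, D. Zagier, *Periods* (2001), §1.2 rule (2); J. Bochnak, M. Coste,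
M.-F. Roy, *Real Algebraic Geometry* (1998), §2.2.
-/

noncomputable section

open Set MeasureTheory MvPolynomial
open Literature.NumberTheory.Transcendental
open Literature.ModelTheory.ExponentialFields (IsSemialgebraic isSemialgebraic_setOf_eval_lt)

namespace Summit.KontsevichZagierPeriods.LinRedNormalForm.WheelThreeSpokes

namespace Moebius

/-! ### The domain `P2` and the target `Q` -/

/-- `P2` is `ℚ`-semialgebraic (six strict polynomial inequalities).
[cite: BochnakCosteRoy1998, Def. 2.1.4] -/
theorem isSemialgebraic_P2 : IsSemialgebraic ℚ {p : Fin 4 → ℝ | 0 < p 0 ∧ 0 < p 1 ∧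
    p 0 + p 1 < 1 ∧ p 1 < p 2 * (1 - p 0) ∧ p 2 < 1 ∧ p 0 * (1 - p 0 - p 1) < p 3 * (1 - p 2)} := by
  have h := (((((isSemialgebraic_setOf_eval_lt (k := ℚ) (R := ℝ) (0 : MvPolynomial (Fin 4) ℚ)
    (X 0)).inter (isSemialgebraic_setOf_eval_lt (k := ℚ) (R := ℝ) (0 : MvPolynomial (Fin 4) ℚ)
    (X 1))).inter (isSemialgebraic_setOf_eval_lt (k := ℚ) (R := ℝ)
    (X 0 + X 1 : MvPolynomial (Fin 4) ℚ) 1)).inter (isSemialgebraic_setOf_eval_lt (k := ℚ)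
    (R := ℝ) (X 1 : MvPolynomial (Fin 4) ℚ) (X 2 * (1 - X 0)))).inter
    (isSemialgebraic_setOf_eval_lt (k := ℚ) (R := ℝ) (X 2 : MvPolynomial (Fin 4) ℚ) 1)).inter
    (isSemialgebraic_setOf_eval_lt (k := ℚ) (R := ℝ)
    (X 0 * (1 - X 0 - X 1) : MvPolynomial (Fin 4) ℚ) (X 3 * (1 - X 2)))
  have hset : {p : Fin 4 → ℝ | 0 < p 0 ∧ 0 < p 1 ∧ p 0 + p 1 < 1 ∧ p 1 < p 2 * (1 - p 0) ∧
      p 2 < 1 ∧ p 0 * (1 - p 0 - p 1) < p 3 * (1 - p 2)} =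
      ((((({x : Fin 4 → ℝ | aeval x (0 : MvPolynomial (Fin 4) ℚ) <
        aeval x (X 0 : MvPolynomial (Fin 4) ℚ)} ∩
      {x : Fin 4 → ℝ | aeval x (0 : MvPolynomial (Fin 4) ℚ) <
        aeval x (X 1 : MvPolynomial (Fin 4) ℚ)}) ∩
      {x : Fin 4 → ℝ | aeval x (X 0 + X 1 : MvPolynomial (Fin 4) ℚ) <
        aeval x (1 : MvPolynomial (Fin 4) ℚ)}) ∩
      {x : Fin 4 → ℝ | aeval x (X 1 : MvPolynomial (Fin 4) ℚ) <
        aeval x (X 2 * (1 - X 0) : MvPolynomial (Fin 4) ℚ)}) ∩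
      {x : Fin 4 → ℝ | aeval x (X 2 : MvPolynomial (Fin 4) ℚ) <
        aeval x (1 : MvPolynomial (Fin 4) ℚ)}) ∩
      {x : Fin 4 → ℝ | aeval x (X 0 * (1 - X 0 - X 1) : MvPolynomial (Fin 4) ℚ) <
        aeval x (X 3 * (1 - X 2) : MvPolynomial (Fin 4) ℚ)}) := by
    ext p
    simp only [mem_setOf_eq, mem_inter_iff, map_zero, map_one, map_add, map_mul, map_sub, aeval_X]
    tauto
  rw [hset]
  exact h

/-- Signs on `P2`: `0 < 1 − u − v`, `0 < w < 1`, `0 < d₂` (hence `α, β, α + βd₂ > 0`).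
[folklore] -/
theorem signs_of_mem_P2 {p : Fin 4 → ℝ} (hp : p ∈ {p : Fin 4 → ℝ | 0 < p 0 ∧ 0 < p 1 ∧
      p 0 + p 1 < 1 ∧ p 1 < p 2 * (1 - p 0) ∧ p 2 < 1 ∧ p 0 * (1 - p 0 - p 1) < p 3 * (1 - p 2)}) :
    0 < 1 - p 0 - p 1 ∧ 0 < p 2 ∧ 0 < 1 - p 2 ∧ 0 < p 3 := by
  obtain ⟨h0, h1, h2, h3, h4, h5⟩ := hp
  have huv : 0 < 1 - p 0 - p 1 := by linarith
  have hu : 0 < 1 - p 0 := by linarith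
  have hw : 0 < p 2 := (mul_pos_iff_of_pos_right hu).mp (h1.trans h3)
  have hw' : 0 < 1 - p 2 := by linarith
  have hd : 0 < p 3 := (mul_pos_iff_of_pos_right hw').mp ((mul_pos h0 huv).trans h5)
  exact ⟨huv, hw, hw', hd⟩

/-- Signs on `Q`: `0 < 1 − u − v`, `0 < w < 1`, `0 < s < 1`. [folklore] -/
theorem signs_of_mem_Q {q : Fin 4 → ℝ} (hq : q ∈ {q : Fin 4 → ℝ | 0 < q 0 ∧ 0 < q 1 ∧
      q 0 + q 1 < 1 ∧ q 1 < q 3 * (1 - q 0) ∧ q 3 < 1 ∧ q 3 * q 0 < q 2 * (q 1 + q 3 * q 0) ∧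
      q 2 < 1}) :
    0 < 1 - q 0 - q 1 ∧ 0 < q 3 ∧ 0 < 1 - q 3 ∧ 0 < q 2 ∧ 0 < 1 - q 2 := by
  obtain ⟨h0, h1, h2, h3, h4, h5, h6⟩ := hq
  have huv : 0 < 1 - q 0 - q 1 := by linarith
  have hu : 0 < 1 - q 0 := by linarith
  have hw : 0 < q 3 := (mul_pos_iff_of_pos_right hu).mp (h1.trans h3)
  have hw' : 0 < 1 - q 3 := by linarith
  have hs : 0 < q 2 :=
    (mul_pos_iff_of_pos_right (add_pos h1 (mul_pos hw h0))).mp ((mul_pos hw h0).trans h5)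
  have hs' : 0 < 1 - q 2 := by linarith
  exact ⟨huv, hw, hw', hs, hs'⟩

/-! ### The Möbius chart `C = P/Q`: values, denominators, Jacobian, injectivity, image -/

/-- Values of the Möbius chart: `C(u, v, w, d₂) = (u, v, βd₂/(α + βd₂), w)`. [folklore] -/
theorem chartM_apply (x : Fin 4 → ℝ) :
    (fun i => aeval x ((![X 0, X 1, X 2 * (1 - X 2) * X 3, X 2] :
        Fin 4 → MvPolynomial (Fin 4) ℚ) i) /
      aeval x ((![1, 1, X 1 * (1 - X 0 - X 1) + X 2 * (1 - X 2) * X 3, 1] :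
        Fin 4 → MvPolynomial (Fin 4) ℚ) i)) =
      ![x 0, x 1, x 2 * (1 - x 2) * x 3 / (x 1 * (1 - x 0 - x 1) + x 2 * (1 - x 2) * x 3),
        x 2] := by
  funext i; fin_cases i <;> simp

/-- The denominators `Qᵢ` of the chart do not vanish on `P2` (`α + βd₂ > 0`). [folklore] -/
theorem aeval_QM_ne_zero : ∀ y ∈ {p : Fin 4 → ℝ | 0 < p 0 ∧ 0 < p 1 ∧ p 0 + p 1 < 1 ∧
      p 1 < p 2 * (1 - p 0) ∧ p 2 < 1 ∧ p 0 * (1 - p 0 - p 1) < p 3 * (1 - p 2)}, ∀ i,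
    aeval y ((![1, 1, X 1 * (1 - X 0 - X 1) + X 2 * (1 - X 2) * X 3, 1] :
      Fin 4 → MvPolynomial (Fin 4) ℚ) i) ≠ 0 := by
  intro y hy i
  obtain ⟨huv, hw, hw', hd⟩ := signs_of_mem_P2 hy
  obtain ⟨-, h1, -, -, -, -⟩ := hy
  have hA : 0 < y 1 * (1 - y 0 - y 1) + y 2 * (1 - y 2) * y 3 := by positivity
  fin_cases i
  · simp
  · simp
  · simpa using hA.ne'
  · simp

/-- The denominator `J_Q = (α + βd₂)²` of the Jacobian determinant does not vanish on `P2`.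
[folklore] -/
theorem aeval_JQM_ne_zero : ∀ y ∈ {p : Fin 4 → ℝ | 0 < p 0 ∧ 0 < p 1 ∧ p 0 + p 1 < 1 ∧
      p 1 < p 2 * (1 - p 0) ∧ p 2 < 1 ∧ p 0 * (1 - p 0 - p 1) < p 3 * (1 - p 2)},
    aeval y ((X 1 * (1 - X 0 - X 1) + X 2 * (1 - X 2) * X 3) ^ 2 : MvPolynomial (Fin 4) ℚ) ≠ 0 := by
  intro y hy
  obtain ⟨huv, hw, hw', hd⟩ := signs_of_mem_P2 hy
  obtain ⟨-, h1, -, -, -, -⟩ := hy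
  simp only [map_pow, map_add, map_mul, map_sub, map_one, aeval_X]
  positivity

/-- Jacobian determinant of the Möbius chart: rows `0, 1, 3` of the Jacobian matrix are the unit
vectors `e₀, e₁, e₂`, so `det = −∂s/∂d₂ = −αβ/(α + βd₂)²`. [folklore] -/
theorem det_chartM : ∀ y ∈ {p : Fin 4 → ℝ | 0 < p 0 ∧ 0 < p 1 ∧ p 0 + p 1 < 1 ∧
      p 1 < p 2 * (1 - p 0) ∧ p 2 < 1 ∧ p 0 * (1 - p 0 - p 1) < p 3 * (1 - p 2)},
    (Matrix.of fun i j =>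
      (aeval y ((![1, 1, X 1 * (1 - X 0 - X 1) + X 2 * (1 - X 2) * X 3, 1] :
          Fin 4 → MvPolynomial (Fin 4) ℚ) i))⁻¹ *
        aeval y (pderiv j ((![X 0, X 1, X 2 * (1 - X 2) * X 3, X 2] :
          Fin 4 → MvPolynomial (Fin 4) ℚ) i)) -
      aeval y ((![X 0, X 1, X 2 * (1 - X 2) * X 3, X 2] : Fin 4 → MvPolynomial (Fin 4) ℚ) i) /
        aeval y ((![1, 1, X 1 * (1 - X 0 - X 1) + X 2 * (1 - X 2) * X 3, 1] :
          Fin 4 → MvPolynomial (Fin 4) ℚ) i) ^ 2 *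
        aeval y (pderiv j ((![1, 1, X 1 * (1 - X 0 - X 1) + X 2 * (1 - X 2) * X 3, 1] :
          Fin 4 → MvPolynomial (Fin 4) ℚ) i)) : Matrix (Fin 4) (Fin 4) ℝ).det =
      aeval y (-(X 1 * (1 - X 0 - X 1)) * (X 2 * (1 - X 2)) : MvPolynomial (Fin 4) ℚ) /
        aeval y ((X 1 * (1 - X 0 - X 1) + X 2 * (1 - X 2) * X 3) ^ 2 :
          MvPolynomial (Fin 4) ℚ) := by
  intro y hy
  have hA : y 1 * (1 - y 0 - y 1) + y 2 * (1 - y 2) * y 3 ≠ 0 := by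
    simpa using aeval_QM_ne_zero y hy 2
  rw [Matrix.det_succ_row_zero]
  simp [Matrix.det_fin_three, Fin.succAbove, Pi.single_apply]
  field_simp
  ring

/-- The Möbius chart is injective on `P2` (`s = βd₂/(α + βd₂)` is a Möbius function of `d₂`
with `αβ ≠ 0`). [folklore] -/
theorem injOn_chartM : InjOn (fun (x : Fin 4 → ℝ) (i : Fin 4) =>
      aeval x ((![X 0, X 1, X 2 * (1 - X 2) * X 3, X 2] : Fin 4 → MvPolynomial (Fin 4) ℚ) i) /
        aeval x ((![1, 1, X 1 * (1 - X 0 - X 1) + X 2 * (1 - X 2) * X 3, 1] :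
          Fin 4 → MvPolynomial (Fin 4) ℚ) i))
    {p : Fin 4 → ℝ | 0 < p 0 ∧ 0 < p 1 ∧ p 0 + p 1 < 1 ∧ p 1 < p 2 * (1 - p 0) ∧ p 2 < 1 ∧
      p 0 * (1 - p 0 - p 1) < p 3 * (1 - p 2)} := by
  intro x hx x' hx' h
  obtain ⟨huv, hw, hw', hd⟩ := signs_of_mem_P2 hx
  obtain ⟨-, h1, -, -, -, -⟩ := hx
  obtain ⟨huv', hv', hw'', hd'⟩ := signs_of_mem_P2 hx'
  obtain ⟨-, h1', -, -, -, -⟩ := hx'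
  have e0 : x 0 = x' 0 := by simpa using congrFun h 0
  have e1 : x 1 = x' 1 := by simpa using congrFun h 1
  have e3 : x 2 = x' 2 := by simpa using congrFun h 3
  have e2 : x 2 * (1 - x 2) * x 3 / (x 1 * (1 - x 0 - x 1) + x 2 * (1 - x 2) * x 3) =
      x' 2 * (1 - x' 2) * x' 3 / (x' 1 * (1 - x' 0 - x' 1) + x' 2 * (1 - x' 2) * x' 3) := by
    simpa using congrFun h 2
  rw [e0, e1, e3] at e2
  rw [e0, e1] at huv
  rw [e3] at hw hw'
  have hA : 0 < x' 1 * (1 - x' 0 - x' 1) + x' 2 * (1 - x' 2) * x 3 := by positivity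
  have hA' : 0 < x' 1 * (1 - x' 0 - x' 1) + x' 2 * (1 - x' 2) * x' 3 := by positivity
  rw [div_eq_div_iff hA.ne' hA'.ne'] at e2
  have hαβ : 0 < x' 1 * (1 - x' 0 - x' 1) * (x' 2 * (1 - x' 2)) := by positivity
  have e2' : x' 1 * (1 - x' 0 - x' 1) * (x' 2 * (1 - x' 2)) * x 3 =
      x' 1 * (1 - x' 0 - x' 1) * (x' 2 * (1 - x' 2)) * x' 3 := by linear_combination e2
  have hx3 : x 3 = x' 3 := mul_left_cancel₀ hαβ.ne' e2'
  funext i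
  fin_cases i
  · exact e0
  · exact e1
  · exact e3
  · exact hx3

/-- The Möbius chart maps `P2` onto `Q` (inverse `d₂ = αs/(β(1 − s))`; the constraint
`u(1−u−v) < d₂(1−w)` becomes `wu < s(v + wu)`, and `s < 1` always). [folklore] -/
theorem image_chartM : (fun (x : Fin 4 → ℝ) (i : Fin 4) =>
      aeval x ((![X 0, X 1, X 2 * (1 - X 2) * X 3, X 2] : Fin 4 → MvPolynomial (Fin 4) ℚ) i) /
        aeval x ((![1, 1, X 1 * (1 - X 0 - X 1) + X 2 * (1 - X 2) * X 3, 1] :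
          Fin 4 → MvPolynomial (Fin 4) ℚ) i)) ''
      {p : Fin 4 → ℝ | 0 < p 0 ∧ 0 < p 1 ∧ p 0 + p 1 < 1 ∧ p 1 < p 2 * (1 - p 0) ∧ p 2 < 1 ∧
        p 0 * (1 - p 0 - p 1) < p 3 * (1 - p 2)} =
    {q : Fin 4 → ℝ | 0 < q 0 ∧ 0 < q 1 ∧ q 0 + q 1 < 1 ∧ q 1 < q 3 * (1 - q 0) ∧ q 3 < 1 ∧
      q 3 * q 0 < q 2 * (q 1 + q 3 * q 0) ∧ q 2 < 1} := by
  ext q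
  constructor
  · rintro ⟨p, hp, rfl⟩
    obtain ⟨huv, hw, hw', hd⟩ := signs_of_mem_P2 hp
    obtain ⟨h0, h1, h2, h3, h4, h5⟩ := hp
    have hα : 0 < p 1 * (1 - p 0 - p 1) := mul_pos h1 huv
    have hβ : 0 < p 2 * (1 - p 2) := mul_pos hw hw'
    have hA : 0 < p 1 * (1 - p 0 - p 1) + p 2 * (1 - p 2) * p 3 := by positivity
    simp only [mem_setOf_eq, chartM_apply, Matrix.cons_val]
    refine ⟨h0, h1, h2, h3, h4, ?_, ?_⟩
    · rw [div_mul_eq_mul_div, lt_div_iff₀ hA]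
      nlinarith [mul_pos (mul_pos hw h1) (sub_pos.2 h5)]
    · rw [div_lt_one hA]
      linarith
  · intro hq
    obtain ⟨huv, hw, hw', hs, hs'⟩ := signs_of_mem_Q hq
    obtain ⟨h0, h1, h2, h3, h4, h5, h6⟩ := hq
    have hα : 0 < q 1 * (1 - q 0 - q 1) := mul_pos h1 huv
    have hβ : 0 < q 3 * (1 - q 3) := mul_pos hw hw'
    refine ⟨![q 0, q 1, q 3, q 1 * (1 - q 0 - q 1) * q 2 / (q 3 * (1 - q 3) * (1 - q 2))],
      ?_, ?_⟩
    · simp only [mem_setOf_eq, Matrix.cons_val]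
      refine ⟨h0, h1, h2, h3, h4, ?_⟩
      rw [div_mul_eq_mul_div, lt_div_iff₀ (by positivity)]
      nlinarith [mul_pos (mul_pos huv hw') (sub_pos.2 h5)]
    · beta_reduce
      rw [chartM_apply]
      simp only [Matrix.cons_val]
      funext i
      fin_cases i
      · rfl
      · rfl
      · show q 3 * (1 - q 3) * (q 1 * (1 - q 0 - q 1) * q 2 / (q 3 * (1 - q 3) * (1 - q 2))) /
          (q 1 * (1 - q 0 - q 1) + q 3 * (1 - q 3) *
            (q 1 * (1 - q 0 - q 1) * q 2 / (q 3 * (1 - q 3) * (1 - q 2)))) = q 2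
        have hα' := hα.ne'
        have hβ' := hβ.ne'
        have hs'' := hs'.ne'
        field_simp
        ring
      · rfl

/-- Pull-back identity of the Möbius chart: `1/(d₂(α + βd₂)) = 1/(αs)·|−αβ/(α + βd₂)²|` at
`s = βd₂/(α + βd₂)`. [folklore] -/
theorem hgh_chartM : ∀ y ∈ {p : Fin 4 → ℝ | 0 < p 0 ∧ 0 < p 1 ∧ p 0 + p 1 < 1 ∧
      p 1 < p 2 * (1 - p 0) ∧ p 2 < 1 ∧ p 0 * (1 - p 0 - p 1) < p 3 * (1 - p 2)},
    (fun p : Fin 4 → ℝ => 1 / (p 3 * (p 1 * (1 - p 0 - p 1) + p 2 * (1 - p 2) * p 3))) y =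
      (fun q : Fin 4 → ℝ => 1 / (q 1 * (1 - q 0 - q 1) * q 2)) (fun i =>
        aeval y ((![X 0, X 1, X 2 * (1 - X 2) * X 3, X 2] : Fin 4 → MvPolynomial (Fin 4) ℚ) i) /
          aeval y ((![1, 1, X 1 * (1 - X 0 - X 1) + X 2 * (1 - X 2) * X 3, 1] :
            Fin 4 → MvPolynomial (Fin 4) ℚ) i)) *
      |aeval y (-(X 1 * (1 - X 0 - X 1)) * (X 2 * (1 - X 2)) : MvPolynomial (Fin 4) ℚ) /
        aeval y ((X 1 * (1 - X 0 - X 1) + X 2 * (1 - X 2) * X 3) ^ 2 :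
          MvPolynomial (Fin 4) ℚ)| := by
  intro y hy
  obtain ⟨huv, hw, hw', hd⟩ := signs_of_mem_P2 hy
  obtain ⟨-, h1, -, -, -, -⟩ := hy
  have hα : 0 < y 1 * (1 - y 0 - y 1) := mul_pos h1 huv
  have hβ : 0 < y 2 * (1 - y 2) := mul_pos hw hw'
  have hA : 0 < y 1 * (1 - y 0 - y 1) + y 2 * (1 - y 2) * y 3 := by positivity
  rw [chartM_apply]
  simp only [Matrix.cons_val, map_neg, map_mul, map_sub, map_add, map_pow, map_one, aeval_X]
  rw [neg_mul, neg_div, abs_neg, abs_of_pos (by positivity)]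
  field_simp

end Moebius

/-! ### The stub -/

open Moebius in
/-- **stub_moebius**: Möbius storage of the would-be logarithm — ONE change of variables
(rule 2) along the rational chart `(u, v, w, d₂) ↦ (u, v, s, w)`, `s = βd₂/(α + βd₂)`,
`α = v(1−u−v)`, `β = w(1−w)`, from `P2` onto `Q` (`|J| = αβ/(α + βd₂)²`, inverse
`d₂ = αs/(β(1−s))`), relating `[P2, 1/(d₂(α + βd₂))]` to `[Q, 1/(v(1−u−v)s)]`, together with the
existence of the `P2` representation transported back from a `Q` one (`ratChart_transport`).
[cite: KontsevichZagier2001, §1.2 rule (2)] -/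
theorem stub_moebius :
    (∀ q : KZ.IntegralRep 4, q.domain = {q : Fin 4 → ℝ | 0 < q 0 ∧ 0 < q 1 ∧ q 0 + q 1 < 1 ∧ q 1 < q 3 * (1 - q 0) ∧ q 3 < 1 ∧ q 3 * q 0 < q 2 * (q 1 + q 3 * q 0) ∧ q 2 < 1} →
      Set.EqOn q.integrand (fun q => 1 / (q 1 * (1 - q 0 - q 1) * q 2)) q.domain →
      ∃ p : KZ.IntegralRep 4, p.domain = {p : Fin 4 → ℝ | 0 < p 0 ∧ 0 < p 1 ∧ p 0 + p 1 < 1 ∧ p 1 < p 2 * (1 - p 0) ∧ p 2 < 1 ∧ p 0 * (1 - p 0 - p 1) < p 3 * (1 - p 2)} ∧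
        p.integrand = fun p => 1 / (p 3 * (p 1 * (1 - p 0 - p 1) + p 2 * (1 - p 2) * p 3))) ∧
    (∀ p q : KZ.IntegralRep 4, p.domain = {p : Fin 4 → ℝ | 0 < p 0 ∧ 0 < p 1 ∧ p 0 + p 1 < 1 ∧ p 1 < p 2 * (1 - p 0) ∧ p 2 < 1 ∧ p 0 * (1 - p 0 - p 1) < p 3 * (1 - p 2)} →
      Set.EqOn p.integrand (fun p => 1 / (p 3 * (p 1 * (1 - p 0 - p 1) + p 2 * (1 - p 2) * p 3))) p.domain →
      q.domain = {q : Fin 4 → ℝ | 0 < q 0 ∧ 0 < q 1 ∧ q 0 + q 1 < 1 ∧ q 1 < q 3 * (1 - q 0) ∧ q 3 < 1 ∧ q 3 * q 0 < q 2 * (q 1 + q 3 * q 0) ∧ q 2 < 1} →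
      Set.EqOn q.integrand (fun q => 1 / (q 1 * (1 - q 0 - q 1) * q 2)) q.domain →
      KZ.of p - KZ.of q ∈ KZ.relations) := by
  have hT := ratChart_transport (![X 0, X 1, X 2 * (1 - X 2) * X 3, X 2])
    (![1, 1, X 1 * (1 - X 0 - X 1) + X 2 * (1 - X 2) * X 3, 1])
    (-(X 1 * (1 - X 0 - X 1)) * (X 2 * (1 - X 2)))
    ((X 1 * (1 - X 0 - X 1) + X 2 * (1 - X 2) * X 3) ^ 2) isSemialgebraic_P2 aeval_QM_ne_zero
    aeval_JQM_ne_zero det_chartM injOn_chartM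
    (fun p : Fin 4 → ℝ => 1 / (p 3 * (p 1 * (1 - p 0 - p 1) + p 2 * (1 - p 2) * p 3)))
    (fun q : Fin 4 → ℝ => 1 / (q 1 * (1 - q 0 - q 1) * q 2)) hgh_chartM
  rw [image_chartM] at hT
  refine ⟨fun q hqd hqi => hT.1 q hqd hqi, fun p q hpd hpi hqd hqi => ?_⟩
  exact hT.2.2 p q hpd (fun y hy => hpi (by rw [hpd]; exact hy)) hqd hqi

end Summit.KontsevichZagierPeriods.LinRedNormalForm.WheelThreeSpokes
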